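import Summits.AnomalousDissipation.AnomalousDissipation.Theorems.SolenoidalFractalHomogenisationLagrangianStepFrameToEulerianKinematics
import HarnessLib

/-!
# K1L_D (stmt-AnomalousDissipation-27980), v2 road (memo L22 §4) step (K3): the CHAIN RULE along a curve for a test that is only
# LIPSCHITZ in time — deterministic form at a point of partial differentiability (helper, `--supports 27980 --as helper`; lead-k1l-onelevel-p1 g7)

For the converse of (C6) the time derivative of the Eulerian test `Φ τ x := Ψ τ (X m r₀ t′(τ) x)` of an admissible distorted test `Ψ` must be
related to `∂_τ Ψ` along the forward flow: `Ψ τ y = Φ τ (γ τ)`, `γ τ = X m t′(τ) r₀ y`.  `Φ` is smooth in `x` with `(τ, x) ↦ ∂_x Φ` jointly continuous,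
but only LIPSCHITZ in `τ`, so the chain rule holds exactly at the points `τ` where `s ↦ Φ s (γ τ)` is differentiable:
**`hasDerivAt_comp_curve_of_partial`** — if `s ↦ F s (c τ)` has derivative `D₁` at `τ` (F the space–time LIFT, `c` a lifted curve with derivative `c′`
at `τ`), the slices `F s` are `C¹` and `(s, v) ↦ D_v F s v` is jointly continuous, then `s ↦ F s (c s)` has derivative `D₁ + D_vF τ (c τ) c′` at `τ`
(mean value inequality in `v` + the one-variable derivative; Hartman, Ordinary Differential Equations, Ch. V §3, the lemma behind Peano's
differentiability theorem).  The measure-theoretic step («for a.e. `(τ, y)` the point is good», by Rademacher-1D + the measure-preserving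
shear) and the torus/flow instance follow in the companion file.
No sorry, no definition, no named fact.  NOT a proof of the converse reading lemma, of `stub_Vmod_EHTthg`, of K1L_D or AD; rung F-D1.A0.
-/

set_option linter.dupNamespace false

noncomputable section

namespace Summit.AnomalousDissipation.AnomalousDissipation.Theorems.SolenoidalFractalHomogenisation.LagrangianStep.FrameConj

open Set Function Filter Topology
open scoped Topology

variable {V : Type*} [NormedAddCommGroup V] [NormedSpace ℝ V]
variable {F : Type*} [NormedAddCommGroup F] [NormedSpace ℝ F]

/-- **Chain rule along a curve at a point of partial differentiability.**  `Fl : ℝ → V → F` has `C¹` slices with `(s, v) ↦ fderiv (Fl s) v`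
jointly continuous at `(τ, c τ)`; `c : ℝ → V` has derivative `c′` at `τ`; and `s ↦ Fl s (c τ)` has derivative `D₁` at `τ`.  Then
`s ↦ Fl s (c s)` has derivative `D₁ + fderiv (Fl τ) (c τ) c′` at `τ`. -/
theorem hasDerivAt_comp_curve_of_partial {Fl : ℝ → V → F} {c : ℝ → V} {τ : ℝ} {c' : V} {D₁ : F}
    (hslice : ∀ s, Differentiable ℝ (Fl s))
    (hcont : ContinuousAt (uncurry fun s v => fderiv ℝ (Fl s) v) (τ, c τ))
    (hc : HasDerivAt c c' τ) (hD₁ : HasDerivAt (fun s => Fl s (c τ)) D₁ τ) :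
    HasDerivAt (fun s => Fl s (c s)) (D₁ + fderiv ℝ (Fl τ) (c τ) c') τ := by
  rw [hasDerivAt_iff_isLittleO_nhds_zero] at hc hD₁ ⊢
  -- split `Fl (τ+h) (c (τ+h)) − Fl τ (c τ)` into the space increment at time `τ+h` and the time increment at the point `c τ`
  have hsplit : ∀ h : ℝ, Fl (τ + h) (c (τ + h)) - Fl τ (c τ) - h • (D₁ + fderiv ℝ (Fl τ) (c τ) c')
      = (Fl (τ + h) (c (τ + h)) - Fl (τ + h) (c τ) - fderiv ℝ (Fl τ) (c τ) (c (τ + h) - c τ))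
        + fderiv ℝ (Fl τ) (c τ) (c (τ + h) - c τ - h • c')
        + (Fl (τ + h) (c τ) - Fl τ (c τ) - h • D₁) := by
    intro h
    simp only [smul_add, map_sub, map_smul]
    abel
  simp_rw [hsplit]
  refine (Asymptotics.IsLittleO.add (Asymptotics.IsLittleO.add ?_ ?_) hD₁)
  · -- the space increment at time `τ + h`: mean value inequality with the jointly continuous derivative
    rw [Asymptotics.isLittleO_iff]
    intro ε hε
    -- `c` is Lipschitz-like at `τ`: `‖c (τ+h) − c τ‖ ≤ (‖c'‖ + 1) |h|` for small `h`
    have hcO : ∀ᶠ h : ℝ in 𝓝 0, ‖c (τ + h) - c τ‖ ≤ (‖c'‖ + 1) * ‖h‖ := by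
      have h1 := hc.def one_pos
      filter_upwards [h1] with h hh
      have : ‖c (τ + h) - c τ‖ ≤ ‖c (τ + h) - c τ - h • c'‖ + ‖h • c'‖ := by
        calc ‖c (τ + h) - c τ‖ = ‖(c (τ + h) - c τ - h • c') + h • c'‖ := by rw [sub_add_cancel]
          _ ≤ _ := norm_add_le _ _
      rw [norm_smul] at this
      nlinarith [this, hh, norm_nonneg h, norm_nonneg c']
    -- joint continuity of the derivative: `‖fderiv (Fl s) v − fderiv (Fl τ) (c τ)‖ ≤ ε/(‖c'‖+1)` near `(τ, c τ)`
    have hK : 0 < ‖c'‖ + 1 := by positivity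
    have hε' : 0 < ε / (‖c'‖ + 1) := div_pos hε hK
    have hnb := Metric.continuousAt_iff.1 hcont (ε / (‖c'‖ + 1)) hε'
    obtain ⟨δ, hδ, hδε⟩ := hnb
    -- continuity of `c` at `τ`
    have hcc : ContinuousAt c τ := (hasDerivAt_iff_isLittleO_nhds_zero.2 hc).continuousAt
    have hcn : ∀ᶠ h : ℝ in 𝓝 0, dist (c (τ + h)) (c τ) < δ / 2 := by
      have hadd : Tendsto (fun h : ℝ => τ + h) (𝓝 0) (𝓝 τ) := by
        simpa using (tendsto_const_nhds (x := τ)).add (Filter.tendsto_id (x := 𝓝 (0:ℝ)))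
      have h2 : Tendsto (fun h : ℝ => c (τ + h)) (𝓝 0) (𝓝 (c τ)) := hcc.tendsto.comp hadd
      exact (Metric.tendsto_nhds.1 h2) (δ / 2) (by positivity)
    have hhn : ∀ᶠ h : ℝ in 𝓝 0, |h| < δ / 2 := by
      have := Metric.tendsto_nhds.1 (continuous_id.tendsto' (0:ℝ) 0 rfl) (δ / 2) (by positivity)
      simpa [Real.dist_eq] using this
    filter_upwards [hcO, hcn, hhn] with h hch hcd hhd
    -- on the segment from `c τ` to `c (τ+h)` at time `τ + h` the derivative is `ε/(‖c'‖+1)`-close to `fderiv (Fl τ) (c τ)`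
    have hseg : ∀ v ∈ segment ℝ (c τ) (c (τ + h)), ‖fderiv ℝ (Fl (τ + h)) v - fderiv ℝ (Fl τ) (c τ)‖ ≤ ε / (‖c'‖ + 1) := by
      intro v hv
      have hvd : dist v (c τ) < δ / 2 := by
        have h1 : dist v (c τ) ≤ dist (c (τ + h)) (c τ) := by
          rw [dist_comm v, dist_comm (c (τ+h))]
          have := (convex_closedBall (c τ) (dist (c τ) (c (τ + h)))).segment_subset (Metric.mem_closedBall_self dist_nonneg)
            (by rw [Metric.mem_closedBall, dist_comm]) hv
          rw [Metric.mem_closedBall] at this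
          rw [dist_comm (c τ)]; exact this
        exact lt_of_le_of_lt h1 hcd
      have hp : dist ((τ + h, v) : ℝ × V) (τ, c τ) < δ := by
        rw [Prod.dist_eq, max_lt_iff]
        refine ⟨?_, by linarith⟩
        rw [Real.dist_eq, add_sub_cancel_left]; linarith
      have := hδε hp
      rw [dist_eq_norm] at this
      exact this.le
    have hMVT := (convex_segment (c τ) (c (τ + h))).norm_image_sub_le_of_norm_fderiv_le'
      (f := Fl (τ + h)) (φ := fderiv ℝ (Fl τ) (c τ))
      (fun v _ => (hslice (τ + h)) v) hseg (left_mem_segment ℝ _ _) (right_mem_segment ℝ _ _)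
    calc ‖Fl (τ + h) (c (τ + h)) - Fl (τ + h) (c τ) - fderiv ℝ (Fl τ) (c τ) (c (τ + h) - c τ)‖
        ≤ ε / (‖c'‖ + 1) * ‖c (τ + h) - c τ‖ := hMVT
      _ ≤ ε / (‖c'‖ + 1) * ((‖c'‖ + 1) * ‖h‖) := mul_le_mul_of_nonneg_left hch hε'.le
      _ = ε * ‖h‖ := by field_simp
  · -- the linear image of the `o(h)` remainder of `c`
    exact (fderiv ℝ (Fl τ) (c τ)).isBigO_comp _ _ |>.trans_isLittleO hc |> fun h => by simpa using h

end Summit.AnomalousDissipation.AnomalousDissipation.Theorems.SolenoidalFractalHomogenisation.LagrangianStep.FrameConj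

end
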